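import Mathlib.RingTheory.MvPolynomial.Basic
import Mathlib.Data.ENat.Basic
import Mathlib.Analysis.Complex.Basic
import Literature.Computability.AlgebraicComplexity.ArithCircuit
import Literature.Computability.AlgebraicComplexity.CircuitDepth
import Literature.Computability.AlgebraicComplexity.ValiantClasses
import HarnessLib

/-!
# Depth reduction to product-depth two (Agrawal–Vinay, Koiran, Tavenas) — named fact

One NAMED FACT (D-0014) for route `ValiantsHypothesis/Depth4` (item `stmt-ValiantsHypothesis-0332`,
hypothesis of the route's assembly): Tavenas' depth reduction for `VP` families over `ℂ`, in the
library's circuit model.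

Printed theorem (Tavenas, *Improved bounds for reduction to depth 4 and depth 3*, Inform. and
Comput. 240 (2015) 2–11 (MFCS 2013), Thm. 1 (depth four), sharpening Agrawal–Vinay FOCS 2008 and
Koiran, Theoret. Comput. Sci. 448 (2012)): a polynomial of degree `d` in `N` variables computed by
an arithmetic circuit of size `s` is computed by a homogeneous `ΣΠ^{[O(√d)]}ΣΠ^{[√d]}` circuit of
size `2^{O(√d · log(ds) )}` (top fan-in `2^{O(√d log(ds))}` and hence that many gates overall up
to a polynomial factor).

Transcription. For a `VP` family `f` (`Literature.Computability.AlgebraicComplexity.IsVPFamily`: number of variables, degree and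
fan-in-two `complexity` all p-bounded, Bürgisser 2000 Def. 2.4; `complexity` is Bürgisser's `L`
up to a factor `≤ 3`) one has `s(n), d(n) ≤ n^a + a`, so `2^{O(√d log(ds))} ≤ (n + 2)^{c √d + c}`
for a constant `c` depending on the family (the base `n + 2 ≥ 2` and the additive `+ c` absorb
small `n`, `d ∈ {0, 1}` and all `O`-constants). A `ΣΠΣΠ` circuit has product-depth `2`
(`ArithCircuit.productDepth`), and `Literature.CplxAlg.productDepthCircuitSize 2` counts the GATES of an
unbounded-fan-in circuit of product-depth `≤ 2` (weighted-sum and product gates,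
Limaye–Srinivasan–Tavenas 2021 model), which is at most Tavenas' size; hence the printed theorem
implies the statement below (which forgets homogeneity and the fan-in bounds). Both the
hypothesis and the conclusion are invariant under constant-factor changes of the size measures.

## References

* S. Tavenas, *Improved bounds for reduction to depth 4 and depth 3*, Inform. and Comput. 240
  (2015) 2–11; MFCS 2013, LNCS 8087, 813–824. Thm. 1.
* M. Agrawal, V. Vinay, *Arithmetic circuits: a chasm at depth four*, FOCS 2008, 67–75.
* P. Koiran, *Arithmetic circuits: the chasm at depth four gets wider*, TCS 448 (2012) 56–65.
* N. Limaye, S. Srinivasan, S. Tavenas, *Superpolynomial lower bounds against low-depth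
  algebraic circuits*, FOCS 2021, §1 (the product-depth model).
-/

noncomputable section

namespace Literature.Computability.AlgebraicComplexity

/-- **Tavenas' depth reduction for `VP` families** (Tavenas, Inform. and Comput. 240 (2015),
Thm. 1; Agrawal–Vinay 2008; Koiran 2012), in the product-depth model of
Limaye–Srinivasan–Tavenas 2021: for every `VP` family `f = (fₙ)` over `ℂ` there is a constant `c`
such that every `fₙ` has an unbounded-fan-in arithmetic circuit of product-depth `≤ 2` (a `ΣΠΣΠ`
circuit) with at most `(n + 2) ^ (c · ⌊√(deg fₙ)⌋ + c)` gates, i.e.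
`productDepthCircuitSize 2 (f n) ≤ (n + 2) ^ (c * Nat.sqrt (f n).totalDegree + c)`. This is the
printed `2^{O(√d log(ds))}` bound specialised to p-bounded `s, d` (see the module docstring for
the bookkeeping); homogeneity and the fan-in bounds `ΣΠ^{[O(√d)]}ΣΠ^{[√d]}` of the printed
conclusion are dropped, so this is WEAKER than print. Named fact (D-0014). [cite: Tavenas2015, Thm. 1; AgrawalVinay2008] -/
def productDepthCircuitSize_two_le_of_isVPFamily : Prop :=
  ∀ {σ : ℕ → Type} [∀ n, Fintype (σ n)] (f : ∀ n, MvPolynomial (σ n) ℂ),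
    IsVPFamily f → ∃ c : ℕ, ∀ n : ℕ,
      productDepthCircuitSize 2 (f n) ≤ ((n + 2 : ℕ∞) ^ (c * Nat.sqrt ((f n).totalDegree) + c))

end Literature.Computability.AlgebraicComplexity
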